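import Mathlib
import HarnessLib
import Literature.MathematicalPhysics.QuantumLattice.HubbardDiagonalQuadraticEffAction
import Literature.MathematicalPhysics.QuantumLattice.HubbardGridCounterQuadratic
import Summits.HubbardSuperconductivity.HubbardSuperconductivity.Theorems.KLProgrammeKLRegimeEngineCovarianceResponseFourLegCT
import Summits.HubbardSuperconductivity.HubbardSuperconductivity.Theorems.KLProgrammeKLRegimeSplitPredicatesV2

/-!
# K3 ENGINE child (stmt-HubbardSuperconductivity-20437 `KLRegimeEngineV17F2`), stub (c) `hshift` producer «(c)-HSHIFT-4LEG»:
# the frame-shift response of the scale-`n` FOUR-leg kernel / PAIR AMPLITUDE `𝒞_n[K](Q;k,k′)` — the mismatch resummation read at one string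

Cell gate-hubbard-kl, seat p2 (g23).  The (c) closer's `hshift` binder compares `𝒞_n[K₂]` with `𝒞_n[K₁]` (`𝒞_n[K] = klPairAmplitude … K n`, a value of
`vertexFn … 4` of `T_n(K) = klEffectiveAction … K klE0 n`).  By k3c4-p2's mismatch resummation (`…TwoVolumeFrameMismatchResum`:
`klEffectiveAction_eq_chain_add_map_mismatchResummed`) `T_n(K₂) = chain_D + S_m·𝒲′[Ψ̃]` and `T_n(K₁) = 𝒲′[Ψ_{K₁}]`
(`𝒲′[s] = effAction (normalCovariance s) (V_U + 𝒩_{K₁})`, `Ψ̃ = Ψ_{K₂}/(1 + Ψ_{K₂}κ_D)`, `m = (1 + Ψ_{K₂}κ_D)⁻¹`, `D = K₂ ⊖ K₁`).  Read at a four-leg string `X`: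

* §1 `kernel_four_effAction_counterQuadratic_eq_zero` — the chain has NO four-leg kernel (`effAction_normalCovariance_diagQuadratic`: the Gaussian integral of a
  diagonal quadratic vertex is a quadratic form; `kernel_gen_mul_gen_of_ne`);
* §2 **`kernel_four_klEffectiveAction_frame_sub_eq`** — THE IDENTITY
  `T_n(K₂)₄(X) − T_n(K₁)₄(X) = (Π_i m(X_i) − 1)·𝒲′[Ψ̃]₄(X) + (𝒲′[Ψ̃]₄(X) − 𝒲′[Ψ_{K₁}]₄(X))` (`kernel_map_mulLeft` for the dressing);
* §3 **`norm_kernel_four_klEffectiveAction_frame_sub_le`** — with the dressing defect `‖Π_i m(X_i) − 1‖ ≤ δ`, `‖𝒲′[Ψ̃]₄(X)‖ ≤ N₄′` and the hypotheses of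
  `covRespCT_norm_kernel_four_mismatch_sub_le` (p670081) along `normalCovariance(Ψ_{K₁} + t·d)`:
  `‖T_n(K₂)₄(X) − T_n(K₁)₄(X)‖ ≤ δ·N₄′ + 30·(#{|ω|<Λ_n}·βL²(200+200B₁)/Λ_n²·fd)·N₆ + 8·(βL²(200+200B₁)/Λ_n²·fd)·S·N₄`, `fd = frameDist K₂ K₁ ≤ Λ_n/4`;
* §4 **`norm_klPairAmplitude_frame_sub_le`** — the same ×`24|β|³L⁶` in the currency of `klPairAmplitude` (`vertexFn … 4 = 4!·(βL²)³·kernel₄`).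

The response is LINEAR in `frameDist K₂ K₁` once `δ ≲ fd/Λ_n` is priced (`m − 1 = −Ψ_{K₂}κ_D·m`); the PRICING of `δ, N₄′, N₆, S, N₄` against the numeral
`klHshiftC = 2⁹⁶` (`…EngineV8DefsHshiftC`) is the open half of located risk #6.  Proofs only; no definitions; nothing about the model's sizes is asserted;
nothing here asserts (c), (C), K3 or superconductivity.  References: BGM 2006 §2.3 (2.21)–(2.24) [cite: BenfattoGiulianiMastropietro2006]; FST 1996 §1
[cite: FeldmanSalmhoferTrubowitz1996]; Salmhofer 1998 §3.1 [cite: Salmhofer1998].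
-/

noncomputable section

namespace Summit.HubbardSuperconductivity.HubbardSuperconductivity.Theorems.EngineV8

set_option linter.dupNamespace false -- summit = problem name (single-conjunct summit), D-0017

open Finset Literature.MathematicalPhysics.QuantumLattice Literature.Probability.LatticeModels GrassmannAlgebra
open Summit.HubbardSuperconductivity.HubbardSuperconductivity.Theorems.TwoPointAssembly
open Summit.HubbardSuperconductivity.HubbardSuperconductivity.Theorems.TwoVolumeDefect
open Summit.HubbardSuperconductivity.HubbardSuperconductivity.Theorems.KLRegimeSplit
open Summit.HubbardSuperconductivity.HubbardSuperconductivity.Theorems.KLProgrammeLegKernels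

variable {L M : ℕ} [NeZero L] [NeZero M]

/-! ## §1 The chain has no four-leg kernel -/

/-- **The Gaussian effective action of a counterterm vertex has no four-leg kernel**: `[effAction (normalCovariance Ψ_{K}) 𝒩_D]₄ = 0`
(it is the dressed quadratic form `Σ (κ/(1+Ψκ))·ψ̂⁺ψ̂⁻`). -/
theorem kernel_four_effAction_counterQuadratic_eq_zero {β : ℝ} (hβ : 0 < β) (μ : ℝ) (K D : TrigPolyC4v) (Λ : ℝ)
    (X : Fin 4 → HubbardFieldIdx L M) :
    kernel ℂ (effAction ℂ (normalCovariance L M (uvSymbolCT L M β μ K Λ)) (counterQuadratic L M β D)) 4 X = 0 := by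
  have hden : ∀ ks : FreqMomentum L M × Fin 2, 1 + uvSymbolCT L M β μ K Λ ks *
      (((D.eval (latticeMomentum L ks.1.2) / (β * (L : ℝ) ^ 2) : ℝ) : ℂ)) ≠ 0 := fun ks =>
    one_add_uvSymbolCT_mul_ofReal_ne_zero hβ μ K Λ _ ks
  rw [counterQuadratic_eq_sum_smul, effAction_normalCovariance_diagQuadratic _ _ hden, kernel_sum]
  exact Finset.sum_eq_zero fun ks _ => by rw [kernel_smul, kernel_gen_mul_gen_of_ne _ _ (by norm_num) X, mul_zero]

/-! ## §2 The identity at one four-leg string -/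

/-- **`T_n(K₂)₄(X) − T_n(K₁)₄(X) = (Π_i m(X_i) − 1)·𝒲′[Ψ̃]₄(X) + (𝒲′[Ψ̃]₄(X) − 𝒲′[Ψ_{K₁}]₄(X))`** — k3c4-p2's mismatch resummation read at a
four-leg string: the chain drops out (§1), the substitution `S_m` multiplies the kernel by the dressing product (`kernel_map_mulLeft`), and
`T_n(K₁) = 𝒲′[Ψ_{K₁}]` by unfolding (`hubbardCovAboveCT_zero_seed_eq_normalCovariance_uvSymbolCT`). -/
theorem kernel_four_klEffectiveAction_frame_sub_eq {β : ℝ} (hβ : 0 < β) (U μ : ℝ) (K₁ K₂ : TrigPolyC4v) (n : ℕ)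
    (hZ₂ : effPartitionFn ℂ (normalCovariance L M (uvSymbolCT L M β μ K₂ (klScale klE0 n)))
      (hubbardInteraction L M β U + counterQuadratic L M β K₂) ≠ 0)
    (X : Fin 4 → HubbardFieldIdx L M) :
    kernel ℂ (klEffectiveAction L M β U μ K₂ klE0 n) 4 X - kernel ℂ (klEffectiveAction L M β U μ K₁ klE0 n) 4 X =
      ((∏ i : Fin 4, (1 + uvSymbolCT L M β μ K₂ (klScale klE0 n) (X i).1 *
            (((fsub K₂ K₁).eval (latticeMomentum L (X i).1.1.2) / (β * (L : ℝ) ^ 2) : ℝ) : ℂ))⁻¹) - 1) *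
          kernel ℂ (effAction ℂ (normalCovariance L M fun ks =>
              uvSymbolCT L M β μ K₂ (klScale klE0 n) ks /
                (1 + uvSymbolCT L M β μ K₂ (klScale klE0 n) ks *
                  (((fsub K₂ K₁).eval (latticeMomentum L ks.1.2) / (β * (L : ℝ) ^ 2) : ℝ) : ℂ)))
            (hubbardInteraction L M β U + counterQuadratic L M β K₁)) 4 X +
        (kernel ℂ (effAction ℂ (normalCovariance L M fun ks =>
              uvSymbolCT L M β μ K₂ (klScale klE0 n) ks /
                (1 + uvSymbolCT L M β μ K₂ (klScale klE0 n) ks *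
                  (((fsub K₂ K₁).eval (latticeMomentum L ks.1.2) / (β * (L : ℝ) ^ 2) : ℝ) : ℂ)))
            (hubbardInteraction L M β U + counterQuadratic L M β K₁)) 4 X -
          kernel ℂ (effAction ℂ (normalCovariance L M (uvSymbolCT L M β μ K₁ (klScale klE0 n)))
            (hubbardInteraction L M β U + counterQuadratic L M β K₁)) 4 X) := by
  have hT₁ : klEffectiveAction L M β U μ K₁ klE0 n =
      effAction ℂ (normalCovariance L M (uvSymbolCT L M β μ K₁ (klScale klE0 n))) (hubbardInteraction L M β U + counterQuadratic L M β K₁) := by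
    rw [klEffectiveAction, hubbardEffectiveActionCT_def, hubbardInteractionCT, hubbardCovAboveCT_zero_seed_eq_normalCovariance_uvSymbolCT]
  rw [klEffectiveAction_eq_chain_add_map_mismatchResummed hβ U μ K₁ K₂ klE0 n hZ₂, hT₁, kernel_add,
    kernel_four_effAction_counterQuadratic_eq_zero hβ μ K₂ (fsub K₂ K₁) _ X, zero_add, kernel_map_mulLeft]
  ring

/-! ## §3 The norm form: dressing defect + the four-leg mismatch door -/

/-- **THE FRAME-SHIFT RESPONSE OF THE SCALE-`n` FOUR-LEG KERNEL AT ONE STRING**: with `s₀ = Ψ_{K₁}`, `s₁ = Ψ̃`, the dressing defect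
`‖Π_i m(X_i) − 1‖ ≤ δ`, `‖𝒲′[Ψ̃]₄(X)‖ ≤ N₄′`, `frameDist K₂ K₁ ≤ Λ_n/4`, and along `normalCovariance(s₀ + t(s₁ − s₀))` (vertex `V_U + 𝒩_{K₁}`):
`Z_t ≠ 0`, six-leg kernels at `(X, Ā, A)` `≤ N₆`, two-leg kernels at `(X̄_i, X_i)` `≤ S`, the four-leg kernel at `X` `≤ N₄`; then
`‖T_n(K₂)₄(X) − T_n(K₁)₄(X)‖ ≤ δ·N₄′ + 30·(#{|ω|<Λ_n}·βL²(200+200B₁)/Λ_n²·fd)·N₆ + 8·(βL²(200+200B₁)/Λ_n²·fd)·S·N₄`, `fd = frameDist K₂ K₁`. -/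
theorem norm_kernel_four_klEffectiveAction_frame_sub_le {β : ℝ} (hβ : 0 < β) {B₁ : ℝ} (hB0 : 0 ≤ B₁) (hB : ∀ y, |deriv salmhoferCutoff y| ≤ B₁)
    (U μ : ℝ) (K₁ K₂ : TrigPolyC4v) (n : ℕ) (hfd : frameDist K₂ K₁ ≤ klScale klE0 n / 4)
    (hZ₂ : effPartitionFn ℂ (normalCovariance L M (uvSymbolCT L M β μ K₂ (klScale klE0 n)))
      (hubbardInteraction L M β U + counterQuadratic L M β K₂) ≠ 0)
    {s₀ s₁ : FreqMomentum L M × Fin 2 → ℂ} (hs₀ : s₀ = uvSymbolCT L M β μ K₁ (klScale klE0 n))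
    (hs₁ : s₁ = fun ks => uvSymbolCT L M β μ K₂ (klScale klE0 n) ks /
      (1 + uvSymbolCT L M β μ K₂ (klScale klE0 n) ks * (((fsub K₂ K₁).eval (latticeMomentum L ks.1.2) / (β * (L : ℝ) ^ 2) : ℝ) : ℂ)))
    (X : Fin 4 → HubbardFieldIdx L M) {δ N₄' N₆ S N₄ : ℝ}
    (hm : ‖(∏ i : Fin 4, (1 + uvSymbolCT L M β μ K₂ (klScale klE0 n) (X i).1 *
            (((fsub K₂ K₁).eval (latticeMomentum L (X i).1.1.2) / (β * (L : ℝ) ^ 2) : ℝ) : ℂ))⁻¹) - 1‖ ≤ δ)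
    (hN4' : ‖kernel ℂ (effAction ℂ (normalCovariance L M s₁) (hubbardInteraction L M β U + counterQuadratic L M β K₁)) 4 X‖ ≤ N₄')
    (hZ : ∀ t ∈ Set.Icc (0 : ℝ) 1, effPartitionFn ℂ (normalCovariance L M s₀ + ((t : ℂ)) • (normalCovariance L M s₁ - normalCovariance L M s₀))
      (hubbardInteraction L M β U + counterQuadratic L M β K₁) ≠ 0)
    (hN6 : ∀ t ∈ Set.Icc (0 : ℝ) 1, ∀ A : HubbardFieldIdx L M,
      ‖kernel ℂ (effAction ℂ (normalCovariance L M s₀ + ((t : ℂ)) • (normalCovariance L M s₁ - normalCovariance L M s₀))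
        (hubbardInteraction L M β U + counterQuadratic L M β K₁)) 6 (Fin.snoc (Fin.snoc X (A.1, 1 - A.2) : Fin 5 → HubbardFieldIdx L M) A)‖ ≤ N₆)
    (hS : ∀ t ∈ Set.Icc (0 : ℝ) 1, ∀ i : Fin 4,
      ‖kernel ℂ (effAction ℂ (normalCovariance L M s₀ + ((t : ℂ)) • (normalCovariance L M s₁ - normalCovariance L M s₀))
        (hubbardInteraction L M β U + counterQuadratic L M β K₁)) 2 ![(((X i).1, 1 - (X i).2) : HubbardFieldIdx L M), X i]‖ ≤ S)
    (hN4 : ∀ t ∈ Set.Icc (0 : ℝ) 1,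
      ‖kernel ℂ (effAction ℂ (normalCovariance L M s₀ + ((t : ℂ)) • (normalCovariance L M s₁ - normalCovariance L M s₀))
        (hubbardInteraction L M β U + counterQuadratic L M β K₁)) 4 X‖ ≤ N₄) :
    ‖kernel ℂ (klEffectiveAction L M β U μ K₂ klE0 n) 4 X - kernel ℂ (klEffectiveAction L M β U μ K₁ klE0 n) 4 X‖ ≤
      δ * N₄' +
        (30 * ((((Finset.univ.filter fun ks : FreqMomentum L M × Fin 2 => |matsubaraFreq β M ks.1.1| < klScale klE0 n).card : ℕ) : ℝ) *
            (β * (L : ℝ) ^ 2 * (200 + 200 * B₁) / klScale klE0 n ^ 2 * frameDist K₂ K₁)) * N₆ +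
          8 * (β * (L : ℝ) ^ 2 * (200 + 200 * B₁) / klScale klE0 n ^ 2 * frameDist K₂ K₁) * S * N₄) := by
  have hΛ : 0 < klScale klE0 n := klth_klScale_pos n
  have hmis := covRespCT_norm_kernel_four_mismatch_sub_le hβ hB0 hB hΛ μ U K₁ K₂ hfd hs₀ hs₁ X hZ hN6 hS hN4
  have hid := kernel_four_klEffectiveAction_frame_sub_eq hβ U μ K₁ K₂ n hZ₂ X
  subst hs₀ hs₁
  rw [hid]
  refine (norm_add_le _ _).trans (add_le_add ?_ hmis)
  rw [norm_mul]
  exact mul_le_mul hm hN4' (norm_nonneg _) ((norm_nonneg _).trans hm)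

/-! ## §4 In the currency of the pair amplitude `𝒞_n[K](Q; k, k′)` -/

/-- `𝒞_n[K](Q;k,k′) = 4!·(βL²)³ · T_n(K)₄(X_{Q,k,k′})` at the pair string (unfolding `klPairAmplitude`, `vertexFn`). -/
theorem klPairAmplitude_eq_const_mul_kernel (β U μ : ℝ) (K : TrigPolyC4v) (n : ℕ) (Q k k' : TorusSite 2 L) :
    klPairAmplitude L M β U μ K n Q k k' =
      (((((4 : ℕ).factorial : ℝ) * (β * (L : ℝ) ^ 2) ^ (4 - 1) : ℝ) : ℂ)) *
        kernel ℂ (klEffectiveAction L M β U μ K klE0 n) 4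
          ![(((omega0 M, k'), 0), 0), ((((omega0 M).rev, Q - k'), 1), 0), ((((omega0 M).rev, Q - k), 1), 1), (((omega0 M, k), 0), 1)] := by
  rw [klPairAmplitude, vertexFn_def]

omit [NeZero L] in
/-- The normalisation constant in norm: `‖4!·(βL²)³‖ = 24·(|β|·L²)³`. -/
theorem norm_pairAmplitude_const (β : ℝ) :
    ‖(((((4 : ℕ).factorial : ℝ) * (β * (L : ℝ) ^ 2) ^ (4 - 1) : ℝ) : ℂ))‖ = 24 * (|β| * (L : ℝ) ^ 2) ^ 3 := by
  rw [Complex.norm_real, Real.norm_eq_abs, show (4 : ℕ).factorial = 24 by rfl]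
  simp [abs_mul, abs_pow]

/-- **THE FRAME-SHIFT RESPONSE OF THE PAIR AMPLITUDE** (`hshift`'s analytic producer, modulo the sizes): under the hypotheses of
`norm_kernel_four_klEffectiveAction_frame_sub_le` at the pair string `X_{Q,k,k′}`,
`‖𝒞_n[K₂](Q;k,k′) − 𝒞_n[K₁](Q;k,k′)‖ ≤ 24(|β|L²)³·(δ·N₄′ + 30·(#{|ω|<Λ_n}·βL²(200+200B₁)/Λ_n²·fd)·N₆ + 8·(βL²(200+200B₁)/Λ_n²·fd)·S·N₄)` — linear in
`fd = frameDist K₂ K₁` once `δ` is priced `∝ fd/Λ_n`. -/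
theorem norm_klPairAmplitude_frame_sub_le {β : ℝ} (hβ : 0 < β) {B₁ : ℝ} (hB0 : 0 ≤ B₁) (hB : ∀ y, |deriv salmhoferCutoff y| ≤ B₁)
    (U μ : ℝ) (K₁ K₂ : TrigPolyC4v) (n : ℕ) (hfd : frameDist K₂ K₁ ≤ klScale klE0 n / 4)
    (hZ₂ : effPartitionFn ℂ (normalCovariance L M (uvSymbolCT L M β μ K₂ (klScale klE0 n)))
      (hubbardInteraction L M β U + counterQuadratic L M β K₂) ≠ 0)
    {s₀ s₁ : FreqMomentum L M × Fin 2 → ℂ} (hs₀ : s₀ = uvSymbolCT L M β μ K₁ (klScale klE0 n))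
    (hs₁ : s₁ = fun ks => uvSymbolCT L M β μ K₂ (klScale klE0 n) ks /
      (1 + uvSymbolCT L M β μ K₂ (klScale klE0 n) ks * (((fsub K₂ K₁).eval (latticeMomentum L ks.1.2) / (β * (L : ℝ) ^ 2) : ℝ) : ℂ)))
    (Q k k' : TorusSite 2 L) {δ N₄' N₆ S N₄ : ℝ}
    (hm : ‖(∏ i : Fin 4, (1 + uvSymbolCT L M β μ K₂ (klScale klE0 n)
            ((![(((omega0 M, k'), 0), 0), ((((omega0 M).rev, Q - k'), 1), 0), ((((omega0 M).rev, Q - k), 1), 1), (((omega0 M, k), 0), 1)] :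
              Fin 4 → HubbardFieldIdx L M) i).1 *
            (((fsub K₂ K₁).eval (latticeMomentum L ((![(((omega0 M, k'), 0), 0), ((((omega0 M).rev, Q - k'), 1), 0),
              ((((omega0 M).rev, Q - k), 1), 1), (((omega0 M, k), 0), 1)] : Fin 4 → HubbardFieldIdx L M) i).1.1.2) / (β * (L : ℝ) ^ 2) : ℝ) : ℂ))⁻¹) - 1‖ ≤ δ)
    (hN4' : ‖kernel ℂ (effAction ℂ (normalCovariance L M s₁) (hubbardInteraction L M β U + counterQuadratic L M β K₁)) 4
      ![(((omega0 M, k'), 0), 0), ((((omega0 M).rev, Q - k'), 1), 0), ((((omega0 M).rev, Q - k), 1), 1), (((omega0 M, k), 0), 1)]‖ ≤ N₄')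
    (hZ : ∀ t ∈ Set.Icc (0 : ℝ) 1, effPartitionFn ℂ (normalCovariance L M s₀ + ((t : ℂ)) • (normalCovariance L M s₁ - normalCovariance L M s₀))
      (hubbardInteraction L M β U + counterQuadratic L M β K₁) ≠ 0)
    (hN6 : ∀ t ∈ Set.Icc (0 : ℝ) 1, ∀ A : HubbardFieldIdx L M,
      ‖kernel ℂ (effAction ℂ (normalCovariance L M s₀ + ((t : ℂ)) • (normalCovariance L M s₁ - normalCovariance L M s₀))
        (hubbardInteraction L M β U + counterQuadratic L M β K₁)) 6
        (Fin.snoc (Fin.snoc ![(((omega0 M, k'), 0), 0), ((((omega0 M).rev, Q - k'), 1), 0), ((((omega0 M).rev, Q - k), 1), 1),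
          (((omega0 M, k), 0), 1)] (A.1, 1 - A.2) : Fin 5 → HubbardFieldIdx L M) A)‖ ≤ N₆)
    (hS : ∀ t ∈ Set.Icc (0 : ℝ) 1, ∀ i : Fin 4,
      ‖kernel ℂ (effAction ℂ (normalCovariance L M s₀ + ((t : ℂ)) • (normalCovariance L M s₁ - normalCovariance L M s₀))
        (hubbardInteraction L M β U + counterQuadratic L M β K₁)) 2
        ![((((![(((omega0 M, k'), 0), 0), ((((omega0 M).rev, Q - k'), 1), 0), ((((omega0 M).rev, Q - k), 1), 1), (((omega0 M, k), 0), 1)] :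
              Fin 4 → HubbardFieldIdx L M) i).1,
            1 - ((![(((omega0 M, k'), 0), 0), ((((omega0 M).rev, Q - k'), 1), 0), ((((omega0 M).rev, Q - k), 1), 1), (((omega0 M, k), 0), 1)] :
              Fin 4 → HubbardFieldIdx L M) i).2) : HubbardFieldIdx L M),
          (![(((omega0 M, k'), 0), 0), ((((omega0 M).rev, Q - k'), 1), 0), ((((omega0 M).rev, Q - k), 1), 1), (((omega0 M, k), 0), 1)] :
              Fin 4 → HubbardFieldIdx L M) i]‖ ≤ S)
    (hN4 : ∀ t ∈ Set.Icc (0 : ℝ) 1,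
      ‖kernel ℂ (effAction ℂ (normalCovariance L M s₀ + ((t : ℂ)) • (normalCovariance L M s₁ - normalCovariance L M s₀))
        (hubbardInteraction L M β U + counterQuadratic L M β K₁)) 4
        ![(((omega0 M, k'), 0), 0), ((((omega0 M).rev, Q - k'), 1), 0), ((((omega0 M).rev, Q - k), 1), 1), (((omega0 M, k), 0), 1)]‖ ≤ N₄) :
    ‖klPairAmplitude L M β U μ K₂ n Q k k' - klPairAmplitude L M β U μ K₁ n Q k k'‖ ≤
      24 * (|β| * (L : ℝ) ^ 2) ^ 3 *
        (δ * N₄' +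
          (30 * ((((Finset.univ.filter fun ks : FreqMomentum L M × Fin 2 => |matsubaraFreq β M ks.1.1| < klScale klE0 n).card : ℕ) : ℝ) *
              (β * (L : ℝ) ^ 2 * (200 + 200 * B₁) / klScale klE0 n ^ 2 * frameDist K₂ K₁)) * N₆ +
            8 * (β * (L : ℝ) ^ 2 * (200 + 200 * B₁) / klScale klE0 n ^ 2 * frameDist K₂ K₁) * S * N₄)) := by
  have h := norm_kernel_four_klEffectiveAction_frame_sub_le hβ hB0 hB U μ K₁ K₂ n hfd hZ₂ hs₀ hs₁ _ hm hN4' hZ hN6 hS hN4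
  rw [klPairAmplitude_eq_const_mul_kernel, klPairAmplitude_eq_const_mul_kernel, ← mul_sub, norm_mul, norm_pairAmplitude_const]
  exact mul_le_mul_of_nonneg_left h (by positivity)

end Summit.HubbardSuperconductivity.HubbardSuperconductivity.Theorems.EngineV8

end
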